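import Literature.Geometry.Lorentzian.BlackHoles
import HarnessLib

/-!
# Barrier catalogue `FinalStateConjecture`: time-periodic Einstein–Klein–Gordon bifurcations of Kerr ("hairy" Kerr black holes; Chodosh–Shlapentokh-Rothman)
(`Literature/Barriers/FinalStateConjecture/`, D-0021; family `gr`, summit `FinalStateConjecture`;
namespace `Literature.Barriers.FinalStateConjecture`)

This file vendors, as a **named fact** (D-0014), the main theorem of O. Chodosh and
Y. Shlapentokh-Rothman, *Time-periodic Einstein–Klein–Gordon bifurcations of Kerr*, Comm. Math.
Phys. 356 (2017) 1155–1250, Thm. 1.1 (p. 4 of arXiv:1510.08025): "There exists Klein–Gordon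
masses `μ² > 0` such that there exists a `1`-parameter family of smooth spacetimes `(𝓜, g_δ)`
and scalar fields `Ψ_δ : 𝓜 → ℂ` indexed by `δ ∈ [0, ε)` such that (1) for each `δ ≥ 0` the pair
`(𝓜, g_δ)` and `Ψ_δ` yields a solution to the Einstein–Klein–Gordon equations with mass `μ²`;
(2) the spacetimes `(𝓜, g_δ)` are all stationary, axisymmetric, asymptotically flat, and posses
a non-degenerate bifurcate event horizon; (3) for `δ > 0` the scalar field `Ψ_δ` is non-zero,
time-periodic, and decays exponentially (in any asymptotically flat chart) along any
asymptotically flat Cauchy hypersurface; (4) the `1`-parameter family bifurcates off the Kerr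
family in the sense that `(𝓜, g_0)` is isometric to a sub-extremal Kerr exterior spacetime with
`0 < |a| < M`, the family is differentiable with respect to `δ` at `δ = 0`, and
`lim_{δ→0} δ⁻¹ Ψ_δ = Ψ̂`, where `Ψ̂` is a non-zero time-periodic solution to the Klein–Gordon
equation on `(𝓜, g_0)`", together with its Cor. 1.1: "There exist Klein–Gordon masses, a
sub-extremal Kerr spacetime, and a small Einstein–Klein–Gordon perturbation such that the scalar
field does not decay to a stationary solution. In particular, as a family of solutions to the
Einstein–Klein–Gordon equations, asymptotic stability does not hold for the Kerr family" — "This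
shows that the addition of even a relatively simple matter model may completely change the
expectations regarding black hole stability and uniqueness" (ibid., p. 4). The rigorous theorem
was preceded by the numerical construction of Herdeiro–Radu, PRL 112 (2014) 221101 ("Kerr
black holes with scalar hair").

* `PseudoRiemannianMetric.reDifferential`, `imDifferential`, `kgStressEnergy`,
  `IsEinsteinKleinGordon` — the Einstein–Klein–Gordon system of CSR §1 for a complex
  scalar field `Ψ` of mass `μ²` on a pseudo-Riemannian manifold, over the prelude curvature API
  (`einsteinTensor`, `dalembertian`, `innerDual`; standing hypothesis `[g.HasLeviCivita]`):
  `Ric − ½ g R = 𝕋`, `𝕋_{αβ} = Re(∂_αΨ ∂_βΨ̄) − ½ g_{αβ} [g^{γδ} Re(∂_γΨ ∂_δΨ̄) + μ²|Ψ|²]`,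
  `□_g Ψ − μ² Ψ = 0` (CSR §1, pp. 3–4; dot-notation extensions of the prelude structure, as
  `PseudoRiemannianMetric.dalembertian_const` in `BlackHoles`).
* `Kerr.timeTranslate` — the flow `φ_s (t*, x⃗) = (t* + s, x⃗)` of the stationary Killing field
  `∂_{t*} = Kerr.stationaryField` on the Kerr–Schild chart domains `Kerr.region a r₀`.
* `IsTimePeriodicField` — `Ψ ∘ φ_s = e^{−iωs} Ψ` (the ansatz `Ψ = e^{−itω} e^{imφ} ψ`, CSR §1.2,
  §2.2).
* `IsHairyKerrFamily M a ε μ g Ψ` — the clauses of Thm. 1.1 that are vendored, for a family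
  `δ ↦ (g_δ, Ψ_δ)` of `C^∞` Lorentzian metrics and complex fields on the FIXED manifold
  `Kerr.exterior M a` (the open domain of outer communications in the ingoing Kerr–Schild chart
  of the prelude), transported along the isometry `(𝓜, g_0) ≅ Kerr_{M,a}` of clause (4).
* `HairyKerrBifurcation` — **the barrier declaration** (structured block in its docstring):
  such a family exists; consequences proved here: the fields `Ψ_δ`, `δ > 0`, are not invariant
  under the stationary flow although each `g_δ` is (`IsHairyKerrFamily.field_not_stationary`,
  Cor. 1.1), while `g_δ → g_{M,a}` and `Ψ_δ → 0` pointwise as `δ → 0⁺`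
  (`IsHairyKerrFamily.tendsto_metric`, `tendsto_field`).
* `HairyKerrBifurcationNarrow` — **the narrowed barrier** (barrier audit, 2026-08-15), a PROVED
  theorem whose docstring is the corrected BARRIER block: from conjunct (1) = the catalogued fact
  `HairyKerrBifurcation` and conjunct (2) = the massless complement
  `Literature.Geometry.Lorentzian.drsr_wave_local_energy_decay_kerr` (CSR Thm. 1.2: "the natural
  analogue of the type of solution we construct … cannot exist when `μ = 0`"), taken as hypotheses,
  it derives the mass dichotomy in consumer form (massive: rotating sub-extremal Kerr bifurcates
  into Einstein–Klein–Gordon solutions with stationary metric and non-zero time-periodic field,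
  converging pointwise to `(g_{M,a}, 0)`; massless: local energy decay of every admissible wave on
  every sub-extremal Kerr exterior); `HairyKerrBifurcationNarrow.of_facts` gives the same
  dichotomy in the words of Cor. 1.1 (the hair is not invariant under the stationary flow,
  `HairyKerrBifurcation.not_asymptotically_stable`). Split review (2026-08-15): the audit had
  recorded the narrowing as a `Prop`-valued named fact `HairyKerrBifurcationNarrow := (1) ∧ (2)`; a
  conjunction of two catalogued named facts is not a proof obligation of its own (it contains its
  parent `HairyKerrBifurcation` as conjunct (1)), so that named fact was merged back into the two
  catalogued facts and the block moved onto this theorem (no named fact added or weakened, D-0026).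

## Barrier audit (2026-08-15): what Cor. 1.1 does and does not block

The audit (refuter seat) found the vendored clauses faithful to Thm. 1.1 (pp. 3–6, 39, 58–59 of
the held arXiv text re-read) and the fact neither junk-provable (the Einstein–Klein–Gordon clause
with `Ψ_δ ≠ 0` is genuine: `𝕋(g, Ψ) = 0` with `μ > 0` forces `Ψ = 0`) nor refutable, but the
`technique_class`/`blocks` wording of the catalogued block broader than the source supports in two
respects, now recorded in the block of `HairyKerrBifurcationNarrow`: (N1) Cor. 1.1 negates
asymptotic stability of the Kerr FAMILY — CSR's Conj. 1.1, "the maximal Cauchy development of a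
small perturbation of sub-extremal Kerr initial data … asymptotically settles down to (a possibly
different) Kerr exterior" (p. 3), i.e. EVERY small perturbation — by exhibiting ONE one-parameter
family of non-decaying solutions; it does not bear on GENERIC-data final-state statements such as
the summit `FinalStateConjecture` (Christodoulou-generic data), about whose matter analogue the
source is silent (its §1.2 lists no stability problem for the hairy black holes, which are
numerically superradiantly unstable in turn: Ganchev–Santos 2018; Degollado–Herdeiro–Radu 2018);
(N2) the target named there, `Development.SettlesToKerrFamily`, is a predicate on the prelude
structure `Development`, which is uninhabited (`Literature.Geometry.Lorentzian.Development.isEmpty`).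
Positively, the audit records that the bifurcating parameters of the printed proof accumulate at
`a = 0` (slowly rotating Kerr is covered) and that, by scaling, every mass `μ² > 0` occurs.

## Why the fixed Kerr–Schild exterior is a faithful carrier (argued here, not proved)

CSR work on `𝓜 = {(t, φ, ρ, z) ∈ ℝ × (0, 2π) × 𝓑}`, `𝓑 = {ρ > 0}` (§3.1), with the ansatz
`g = −V dt² + 2W dt dφ + X dφ² + e^{2λ}(dρ² + dz²)`, `V, W, X, λ : 𝓑 → ℝ` (§2.1, p. 7;
§3.1, p. 11), so that `T = ∂_t` and `Φ = ∂_φ` are Killing for every member of the family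
(§2.1: "where `T ≐ ∂_t` and `Φ ≐ ∂_φ` are Killing vector fields"; companion paper
Chodosh–Shlapentokh-Rothman, Comm. Anal. Geom. 29 (2021), §1: "Observe that the vector fields
`Φ ≐ ∂_φ` and `T ≐ ∂_t` are both Killing"), and with `Ψ(t, φ, ρ, z) = e^{−itω} e^{imφ} ψ(ρ, z)`,
`ψ` real, `m` a non-zero integer (§1.2, p. 6; §2.2, p. 7; Rmk. 1.6); the solutions are then
extended across the axis and to the horizon (§13.1). Here `t, φ` are the Boyer–Lindquist
time and azimuth of the reference Kerr metric and `(ρ, z) = (√Δ sin θ, (r̃ − M) cos θ)` are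
isothermal coordinates in the `(r̃, θ)`-plane (§3, p. 11); since `M(δ)² − a(δ)² = γ²` is kept
fixed along the family of Thm. 1.1 (§13.4, Lemma 13.4.1), all `g_δ` live on the same coordinate
manifold. The ingoing Kerr–Schild coordinates of the prelude differ from Boyer–Lindquist ones
by `t* = t + f(r̃)`, `φ* = φ + h(r̃)`, so the coordinate fields agree:
`∂_t = ∂_{t*} = Kerr.stationaryField` and `∂_φ = ∂_{φ*} = x¹∂₂ − x²∂₁ = Kerr.axialField`, and
the `t`-translation flow is `Kerr.timeTranslate`. Transporting `(g_δ, Ψ_δ)` along the fixed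
identification of the open domain of outer communications with `Kerr.exterior M a = {r > r₊}`
(an isometry for `δ = 0`) gives a family as in `IsHairyKerrFamily`: the Einstein–Klein–Gordon
equations, the Killing property and the phase law `Ψ ∘ φ_s = e^{−iωs} Ψ` are
diffeomorphism-invariant statements.

## Mathlib

No Lorentzian geometry, no Einstein or Klein–Gordon equations in Mathlib; in the tree,
`lean search 'KleinGordon|stressEnergy|energyMomentum' --decl` finds only the (linear) barrier
`KleinGordonSuperradiantInstability` and its `kgSliceEnergy`, no energy–momentum tensor. Used:
`mfderiv`, `LinearMap.BilinForm.linMulLin`, `Module.Dual`, `HasDerivWithinAt`,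
`DifferentiableWithinAt`, `Complex.exp`. The prelude supplies `einsteinTensor`, `dalembertian`,
`innerDual`, `IsKillingField`, `Kerr.smoothMetric`, `Kerr.stationaryField`, `Kerr.axialField`.

## References

* O. Chodosh, Y. Shlapentokh-Rothman, *Time-periodic Einstein–Klein–Gordon bifurcations of
  Kerr*, Comm. Math. Phys. 356 (2017) 1155–1250 (arXiv:1510.08025): abstract; Thm. 1.1, Rmks.
  1.1–1.4 and Cor. 1.1 (p. 4); §1 (pp. 3–4: the Einstein–Klein–Gordon system); §1.1.1
  (Thms. 1.2–1.3, p. 5); §1.1.2 (p. 5); §1.2 and Rmk. 1.6 (p. 6); §2.1–§2.2 (pp. 7–8); §2.4.4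
  (p. 10); §3 and §3.1 (p. 11); §10.2 (p. 39: `ω ≠ 0`); §11 (Lemma 11.1.1, p. 40); Thm. 13.1,
  Prop. 13.2.1 and §13.4 (pp. 57–59). Section, page and statement numbers are those of the held
  arXiv version; agreement with the journal's numbering is not verified here.
* O. Chodosh, Y. Shlapentokh-Rothman, *Stationary axisymmetric black holes with matter*, Comm.
  Anal. Geom. 29 (2021) 19–76 (arXiv:1510.08024), §1.
* C. A. R. Herdeiro, E. Radu, *Kerr black holes with scalar hair*, Phys. Rev. Lett. 112 (2014)
  221101.
* Y. Shlapentokh-Rothman, *Exponentially growing finite energy solutions for the Klein–Gordon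
  equation on sub-extremal Kerr spacetimes*, Comm. Math. Phys. 329 (2014) 859–891.
* M. Dafermos, I. Rodnianski, Y. Shlapentokh-Rothman, *Decay for solutions of the wave equation
  on Kerr exterior spacetimes III*, Ann. of Math. 183 (2016) 787–913.
* B. Ganchev, J. E. Santos, *Scalar hairy black holes in four dimensions are unstable*, Phys.
  Rev. Lett. 120 (2018) 171101 (arXiv:1711.08464), abstract and §1.
* J. C. Degollado, C. A. R. Herdeiro, E. Radu, *Effective stability against superradiance of Kerr
  black holes with synchronised hair*, Phys. Lett. B 781 (2018) 651–655 (arXiv:1802.07266),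
  pp. 2–3 and 6 of the arXiv text.
* J. Bičák, M. Scholtz, P. Tod, *On asymptotically flat solutions of Einstein's equations
  periodic in time II. Spacetimes with scalar-field sources*, Class. Quantum Grav. 27 (2010)
  175011 (arXiv:1008.0248), §1 (Thm. 1 and the paragraph following it).
* M. Dafermos, J. Luk, *The interior of dynamical vacuum black holes I*, arXiv:1710.01722, p. 8
  (the generic-data final state conjecture).
-/

noncomputable section

open Set Filter Topology
open scoped Manifold ContDiff

namespace Literature.Barriers.FinalStateConjecture

/-! ### The Einstein–Klein–Gordon system (Chodosh–Shlapentokh-Rothman, §1) -/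

section PseudoRiemannianMetric
open Literature.Geometry.Lorentzian (PseudoRiemannianMetric)
open Literature.Geometry.Lorentzian.PseudoRiemannianMetric

variable {E : Type*} [NormedAddCommGroup E] [NormedSpace ℝ E] {H : Type*} [TopologicalSpace H]
  {I : ModelWithCorners ℝ E H} {M : Type*} [TopologicalSpace M] [ChartedSpace H M]
  [IsManifold I ∞ M] {n : ℕ∞ω}

variable (I) in
/-- The differential `d(Re Ψ)_x` of the real part of a complex scalar field `Ψ : M → ℂ`, as an
algebraic covector on `T_x M` (the manifold derivative `mfderiv` of `y ↦ Re Ψ(y)`, forgetting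
continuity). With `imDifferential` it encodes `∂Ψ = ∂(Re Ψ) + i ∂(Im Ψ)` in the
energy–momentum tensor of Chodosh–Shlapentokh-Rothman, CMP 356 (2017), §1 (p. 3).
[cite: ChodoshShlapentokhrothman2017, §1 (p. 3)] -/
def _root_.Literature.Geometry.Lorentzian.PseudoRiemannianMetric.reDifferential (Ψ : M → ℂ) (x : M) : Module.Dual ℝ (TangentSpace I x) :=
  (mfderiv I 𝓘(ℝ, ℝ) (fun y ↦ (Ψ y).re) x).toLinearMap

variable (I) in
/-- The differential `d(Im Ψ)_x` of the imaginary part of a complex scalar field `Ψ : M → ℂ`, as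
an algebraic covector on `T_x M`. Chodosh–Shlapentokh-Rothman, CMP 356 (2017), §1 (p. 3).
[cite: ChodoshShlapentokhrothman2017, §1 (p. 3)] -/
def _root_.Literature.Geometry.Lorentzian.PseudoRiemannianMetric.imDifferential (Ψ : M → ℂ) (x : M) : Module.Dual ℝ (TangentSpace I x) :=
  (mfderiv I 𝓘(ℝ, ℝ) (fun y ↦ (Ψ y).im) x).toLinearMap

omit [IsManifold I ∞ M] in
/-- The zero field has zero differential (real part). [folklore] -/
@[simp]
theorem _root_.Literature.Geometry.Lorentzian.PseudoRiemannianMetric.reDifferential_zero [IsManifold I ∞ M] (x : M) : reDifferential I (0 : M → ℂ) x = 0 := by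
  simp only [reDifferential, Pi.zero_apply, Complex.zero_re, mfderiv_const,
    ContinuousLinearMap.toLinearMap_zero]
  rfl

omit [IsManifold I ∞ M] in
/-- The zero field has zero differential (imaginary part). [folklore] -/
@[simp]
theorem _root_.Literature.Geometry.Lorentzian.PseudoRiemannianMetric.imDifferential_zero [IsManifold I ∞ M] (x : M) : imDifferential I (0 : M → ℂ) x = 0 := by
  simp only [imDifferential, Pi.zero_apply, Complex.zero_im, mfderiv_const,
    ContinuousLinearMap.toLinearMap_zero]
  rfl

variable [FiniteDimensional ℝ E]
variable (g : PseudoRiemannianMetric I n E (TangentSpace I : M → Type _))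

/-- **The energy–momentum tensor of a complex scalar field of mass `μ²`** at `x`:
`𝕋_{αβ} = Re(∂_αΨ ∂_βΨ̄) − ½ g_{αβ} [g^{γδ} Re(∂_γΨ ∂_δΨ̄) + μ² |Ψ|²]`, written with
`Re(∂_αΨ ∂_βΨ̄) = ∂_α(Re Ψ) ∂_β(Re Ψ) + ∂_α(Im Ψ) ∂_β(Im Ψ)`, the inverse metric `g^{γδ}` being
the prelude's `innerDual` and `|Ψ|² = Complex.normSq Ψ`. Chodosh–Shlapentokh-Rothman, CMP 356
(2017), §1, p. 3 (the display defining `𝕋_{αβ}`; their normalisation: no `8π`, "a scalar field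
of mass `μ² ≥ 0`"). [cite: ChodoshShlapentokhrothman2017, §1 (p. 3)] -/
def _root_.Literature.Geometry.Lorentzian.PseudoRiemannianMetric.kgStressEnergy (μsq : ℝ) (Ψ : M → ℂ) (x : M) : LinearMap.BilinForm ℝ (TangentSpace I x) :=
  LinearMap.BilinForm.linMulLin (reDifferential I Ψ x) (reDifferential I Ψ x) +
      LinearMap.BilinForm.linMulLin (imDifferential I Ψ x) (imDifferential I Ψ x) -
    ((1 / 2 : ℝ) * (g.innerDual x (reDifferential I Ψ x) (reDifferential I Ψ x) +
        g.innerDual x (imDifferential I Ψ x) (imDifferential I Ψ x) +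
        μsq * Complex.normSq (Ψ x))) • g.toBilinForm x

/-- Evaluation of the energy–momentum tensor on a pair of tangent vectors:
`𝕋(v, w) = d(Re Ψ)(v) d(Re Ψ)(w) + d(Im Ψ)(v) d(Im Ψ)(w)`
`− ½ [g⁻¹(dRe Ψ, dRe Ψ) + g⁻¹(dIm Ψ, dIm Ψ) + μ²|Ψ|²] g(v, w)`. Chodosh–Shlapentokh-Rothman,
CMP 356 (2017), §1 (p. 3). [cite: ChodoshShlapentokhrothman2017, §1 (p. 3)] -/
theorem _root_.Literature.Geometry.Lorentzian.PseudoRiemannianMetric.kgStressEnergy_apply (μsq : ℝ) (Ψ : M → ℂ) (x : M) (v w : TangentSpace I x) :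
    g.kgStressEnergy μsq Ψ x v w =
      reDifferential I Ψ x v * reDifferential I Ψ x w +
        imDifferential I Ψ x v * imDifferential I Ψ x w -
      (1 / 2 : ℝ) * (g.innerDual x (reDifferential I Ψ x) (reDifferential I Ψ x) +
        g.innerDual x (imDifferential I Ψ x) (imDifferential I Ψ x) +
        μsq * Complex.normSq (Ψ x)) * g.val x v w := by
  simp [kgStressEnergy]

/-- The energy–momentum tensor of the zero field vanishes (so the Einstein–Klein–Gordon system
with `Ψ = 0` is the vacuum equation `G = 0`). Chodosh–Shlapentokh-Rothman, CMP 356 (2017), §1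
(pp. 3–4: `Ric(g) = 0` versus `Ric − ½ g R = 𝕋`).
[cite: ChodoshShlapentokhrothman2017, §1 (pp. 3–4)] -/
@[simp]
theorem _root_.Literature.Geometry.Lorentzian.PseudoRiemannianMetric.kgStressEnergy_zero (μsq : ℝ) (x : M) : g.kgStressEnergy μsq (0 : M → ℂ) x = 0 := by
  ext v w
  simp [kgStressEnergy_apply, PseudoRiemannianMetric.innerDual]

variable [CompleteSpace E] [Fact (1 ≤ n)]

/-- **The Einstein–Klein–Gordon equations** for a metric `g` and a complex scalar field `Ψ` of
mass `μ²` (under the standing Levi-Civita hypothesis `[g.HasLeviCivita]` of the curvature API):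
`Ric(g) − ½ g R(g) = 𝕋(g, Ψ)` pointwise as bilinear forms on `T_x M` (`einsteinTensor`,
`kgStressEnergy`), together with the Klein–Gordon equation `□_g Ψ − μ² Ψ = 0`, imposed on the
real and imaginary parts (`dalembertian` is real-valued). CSR note that the Klein–Gordon
equation follows from the Einstein equations with this `𝕋` by the contracted Bianchi identity;
it is recorded as a clause nonetheless ("any solution [...] must satisfy `□_gΨ − μ²Ψ = 0` [...] We
thus refer to [these] as the Einstein–Klein–Gordon (EKG) equations"). Chodosh–Shlapentokh-Rothman,
CMP 356 (2017), §1 (pp. 3–4). [cite: ChodoshShlapentokhrothman2017, §1 (pp. 3–4)] -/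
structure _root_.Literature.Geometry.Lorentzian.PseudoRiemannianMetric.IsEinsteinKleinGordon [g.HasLeviCivita] (μsq : ℝ) (Ψ : M → ℂ) : Prop where
  /-- `G(g)_x = 𝕋(g, Ψ)_x` for every `x`. -/
  einstein : ∀ x : M, g.einsteinTensor x = g.kgStressEnergy μsq Ψ x
  /-- `□_g (Re Ψ) = μ² Re Ψ`. -/
  kleinGordon_re : ∀ x : M, g.dalembertian (fun y ↦ (Ψ y).re) x = μsq * (Ψ x).re
  /-- `□_g (Im Ψ) = μ² Im Ψ`. -/
  kleinGordon_im : ∀ x : M, g.dalembertian (fun y ↦ (Ψ y).im) x = μsq * (Ψ x).im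

/-- With the zero field, the Einstein–Klein–Gordon system is the vacuum equation `G(g) = 0`
(constants solve the wave equation, `dalembertian_const`). Chodosh–Shlapentokh-Rothman, CMP 356
(2017), §1 (pp. 3–4). [cite: ChodoshShlapentokhrothman2017, §1 (pp. 3–4)] -/
theorem _root_.Literature.Geometry.Lorentzian.PseudoRiemannianMetric.isEinsteinKleinGordon_zero_iff [g.HasLeviCivita] (μsq : ℝ) :
    g.IsEinsteinKleinGordon μsq (0 : M → ℂ) ↔ ∀ x : M, g.einsteinTensor x = 0 := by
  constructor
  · intro h x
    simpa using h.einstein x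
  · intro h
    refine ⟨fun x ↦ by simpa using h x, fun x ↦ ?_, fun x ↦ ?_⟩
    · simpa using g.dalembertian_const 0 x
    · simpa using g.dalembertian_const 0 x

end PseudoRiemannianMetric

/-! ### The stationary flow of the Kerr–Schild chart -/

namespace Kerr

/-- The spatial projection kills the time axis: `spatial(e₀) = 0`. [folklore] -/
theorem spatial_basisVector_zero : Literature.Geometry.Lorentzian.E4.spatial (Literature.Geometry.Lorentzian.E4.basisVector 0) = 0 := by
  ext i
  simp [Literature.Geometry.Lorentzian.E4.spatial_apply, Literature.Geometry.Lorentzian.E4.basisVector, Fin.succ_ne_zero]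

/-- Translating a point of `E4` along the time axis does not change its Kerr–Schild radius
(`r(a, x)` depends on `(x¹, x², x³)` only; Kerr–Schild 1965; Visser, arXiv:0706.0622, (35)).
[cite: arXiv07060622, (35)] -/
theorem radius_add_smul_basisVector_zero (a s : ℝ) (x : Literature.Geometry.Lorentzian.E4) :
    Literature.Geometry.Lorentzian.Kerr.radius a (x + s • Literature.Geometry.Lorentzian.E4.basisVector 0) = Literature.Geometry.Lorentzian.Kerr.radius a x := by
  have h3 : (x + s • Literature.Geometry.Lorentzian.E4.basisVector 0) 3 = x 3 := by simp [Literature.Geometry.Lorentzian.E4.basisVector]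
  have hn : Literature.Geometry.Lorentzian.E4.spatialNorm (x + s • Literature.Geometry.Lorentzian.E4.basisVector 0) = Literature.Geometry.Lorentzian.E4.spatialNorm x := by
    simp [Literature.Geometry.Lorentzian.E4.spatialNorm, map_add, map_smul, spatial_basisVector_zero]
  simp only [Literature.Geometry.Lorentzian.Kerr.radius, hn, h3]

/-- **The stationary flow** `φ_s` of the Kerr–Schild chart domain `Kerr.region a r₀`: translation
by `s` along the time axis, `φ_s(t*, x⃗) = (t* + s, x⃗)`, i.e. the flow of the stationary
Killing field `∂_{t*} = Kerr.stationaryField` (constant components `(1, 0, 0, 0)`); it preserves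
the chart domain since `r` is unchanged. (Deliberate dot-notation extension of the prelude
namespace `Literature.Lorentz.Kerr`; compare `Kerr.atTime` of the Price-law barrier file, the same flow
parametrised by target time.) Dafermos–Rodnianski, arXiv:0811.0354, §5.1 (the `t*`-translations
`φ_τ`); O'Neill 1995, Ch. 2, §2.2. [cite: arXiv08110354, §5.1] -/
def timeTranslate (a r₀ s : ℝ) (x : Literature.Geometry.Lorentzian.Kerr.region a r₀) : Literature.Geometry.Lorentzian.Kerr.region a r₀ :=
  ⟨(x : Literature.Geometry.Lorentzian.E4) + s • Literature.Geometry.Lorentzian.E4.basisVector 0, by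
    rw [Literature.Geometry.Lorentzian.Kerr.mem_region, radius_add_smul_basisVector_zero]
    exact x.2⟩

/-- Coordinates of the translated point: `φ_s(x) = x + s e₀`. [folklore] -/
@[simp]
theorem coe_timeTranslate (a r₀ s : ℝ) (x : Literature.Geometry.Lorentzian.Kerr.region a r₀) :
    (timeTranslate a r₀ s x : Literature.Geometry.Lorentzian.E4) = (x : Literature.Geometry.Lorentzian.E4) + s • Literature.Geometry.Lorentzian.E4.basisVector 0 :=
  rfl

/-- `φ_0 = id`. [folklore] -/
@[simp]
theorem timeTranslate_zero (a r₀ : ℝ) (x : Literature.Geometry.Lorentzian.Kerr.region a r₀) : timeTranslate a r₀ 0 x = x := by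
  ext1
  simp

/-- The flow law `φ_s ∘ φ_u = φ_{u + s}`. [folklore] -/
theorem timeTranslate_timeTranslate (a r₀ s u : ℝ) (x : Literature.Geometry.Lorentzian.Kerr.region a r₀) :
    timeTranslate a r₀ s (timeTranslate a r₀ u x) = timeTranslate a r₀ (u + s) x := by
  ext1
  simp [add_smul, add_assoc]

end Kerr

end Literature.Barriers.FinalStateConjecture

namespace Literature.Barriers.FinalStateConjecture

open Literature.Geometry.Lorentzian

/-! ### Time-periodic fields and the vendored clauses of CSR Thm. 1.1 -/

/-- A complex field `Ψ` on the Kerr–Schild chart domain is **time-periodic with frequency `ω`**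
if it transforms under the stationary flow by a phase: `Ψ(φ_s x) = e^{−iωs} Ψ(x)` for all `s`,
`x` — the form `Ψ(t, φ, ρ, z) = e^{−itω} e^{imφ} ψ(ρ, z)` of the scalar fields of
Chodosh–Shlapentokh-Rothman (CMP 356 (2017), §1.2, p. 6 and §2.2, p. 7), read along
`∂_t = ∂_{t*}` (module docstring). In code the frequency is the binder `ϖ` (`ω` is Mathlib's
notation for the analytic regularity class). [cite: ChodoshShlapentokhrothman2017, §1.2 and §2.2] -/
def IsTimePeriodicField (a r₀ : ℝ) (Ψ : Kerr.region a r₀ → ℂ) (ϖ : ℝ) : Prop :=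
  ∀ (s : ℝ) (x : Kerr.region a r₀),
    Ψ (Kerr.timeTranslate a r₀ s x) = Complex.exp (-((ϖ * s : ℝ) : ℂ) * Complex.I) * Ψ x

/-- The zero field is time-periodic with every frequency. [folklore] -/
theorem isTimePeriodicField_zero (a r₀ ϖ : ℝ) :
    IsTimePeriodicField a r₀ (0 : Kerr.region a r₀ → ℂ) ϖ :=
  fun _ _ ↦ by simp

/-- A time-periodic field with non-zero frequency which does not vanish identically is **not
stationary**: it is not invariant under the stationary flow (at `s = π/ω` the phase is `−1`).
This is the form in which "the scalar field does not decay to a stationary solution"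
(Chodosh–Shlapentokh-Rothman, CMP 356 (2017), Cor. 1.1) is consumed below.
[cite: ChodoshShlapentokhrothman2017, Cor. 1.1] -/
theorem IsTimePeriodicField.exists_ne {a r₀ ϖ : ℝ} {Ψ : Kerr.region a r₀ → ℂ}
    (hΨ : IsTimePeriodicField a r₀ Ψ ϖ) (hϖ : ϖ ≠ 0) {x : Kerr.region a r₀} (hx : Ψ x ≠ 0) :
    ∃ s : ℝ, Ψ (Kerr.timeTranslate a r₀ s x) ≠ Ψ x := by
  refine ⟨Real.pi / ϖ, ?_⟩
  rw [hΨ]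
  have hphase : Complex.exp (-((ϖ * (Real.pi / ϖ) : ℝ) : ℂ) * Complex.I) = -1 := by
    rw [mul_div_cancel₀ _ hϖ]
    simp
  rw [hphase]
  intro h
  apply hx
  have : (2 : ℂ) * Ψ x = 0 := by linear_combination -h
  simpa using this

/-- **The vendored clauses of Chodosh–Shlapentokh-Rothman's Theorem 1.1**, for a family
`δ ↦ (g_δ, Ψ_δ)`, `δ ∈ [0, ε)`, of `C^∞` Lorentzian metrics and complex scalar fields on the
fixed manifold `Kerr.exterior M a = {r > r₊}` (ingoing Kerr–Schild chart of the prelude; the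
transport along the isometry of clause (4) is argued in the module docstring), with
Klein–Gordon mass `μ²`, `μ > 0`:
* `param`: `0 < |a| < M`, `0 < ε`, `0 < μ` (Thm. 1.1: "`μ² > 0`", "`0 < |a| < M`");
* `metric_zero`, `field_zero`: `g_0` is the Kerr metric `g_{M,a}` (`Kerr.smoothMetric`) and
  `Ψ_0 = 0` (clause (4): `(𝓜, g_0)` is isometric to Kerr; `Ψ_0 = 0` since `g_0` is vacuum and
  `δ⁻¹Ψ_δ` converges);
* `smooth`, `ekg`: each `Ψ_δ` is `C^∞` and `(g_δ, Ψ_δ)` solves the Einstein–Klein–Gordon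
  equations with mass `μ²` (clause (1); "smooth spacetimes"), under the standing hypothesis
  `[(g δ).HasLeviCivita]` (D-0014 idiom, as `Kerr.isRicciFlat`);
* `killing`: `∂_{t*}` and `∂_{φ*}` (`Kerr.stationaryField`, `Kerr.axialField`) are Killing
  fields of every `g_δ` (clause (2): "stationary, axisymmetric"; §2.1, p. 7 and §3.1, p. 11:
  `T = ∂_t`, `Φ = ∂_φ` Killing for the ansatz);
* `periodic`: each `Ψ_δ` is time-periodic with a non-zero frequency,
  `Ψ_δ ∘ φ_s = e^{−iω_δ s} Ψ_δ` (clause (3) and the ansatz of §1.2, §2.2; `ω ≠ 0`: "for `ε`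
  sufficiently small, `ω` cannot vanish, as long as we started with a Kerr solution with non-zero
  angular momentum", §10.2, p. 39);
* `nonzero`: `Ψ_δ ≠ 0` for `δ > 0` (clause (3));
* `metric_differentiable`, `field_hasDeriv`: the metric coefficients `δ ↦ g_δ(x)(v, w)` are
  differentiable at `δ = 0` from the right, and `δ ↦ Ψ_δ(x)` has right derivative `Ψ̂(x)` at
  `δ = 0`, where `Ψ̂ ≠ 0` is a `C^∞` time-periodic solution of the Klein–Gordon equation of mass
  `μ²` on Kerr (clause (4), read pointwise; Rmk. 1.3: "coordinates in which the metric `g_δ` has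
  coefficients (depending on `δ`) which are differentiable at `δ = 0`").
Not vendored: asymptotic flatness of `g_δ`, the non-degenerate bifurcate event horizon, the
exponential decay of `Ψ_δ` (clauses (2)–(3)), see `scope_caveats` of `HairyKerrBifurcation`.
Instance hypotheses `[Kerr.Facts] [Kerr.SliceFacts]` carry the Kerr metric and its Levi-Civita
connection (`Kerr.hasLeviCivita_smoothMetric`). Chodosh–Shlapentokh-Rothman, CMP 356 (2017),
Thm. 1.1 (p. 4), with §1 (pp. 3–4), §1.2, §2.1–§2.2, §3 and §10.2 (p. 39).
[cite: ChodoshShlapentokhrothman2017, Thm. 1.1] -/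
structure IsHairyKerrFamily [Kerr.Facts] [Kerr.SliceFacts] (M a ε μ : ℝ)
    (g : ℝ → LorentzianMetric 𝓘(ℝ, E4) ∞ (Kerr.exterior M a))
    (Ψ : ℝ → Kerr.exterior M a → ℂ) : Prop where
  /-- `0 < |a| < M`, `ε > 0`, `μ > 0`. -/
  param : 0 < |a| ∧ |a| < M ∧ 0 < ε ∧ 0 < μ
  /-- `g_0` is the Kerr metric `g_{M,a}` on `{r > r₊}`. -/
  metric_zero : g 0 = Kerr.smoothMetric M a (Kerr.rPlus M a)
  /-- `Ψ_0 = 0`. -/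
  field_zero : Ψ 0 = 0
  /-- Each `Ψ_δ` is smooth. -/
  smooth : ∀ δ ∈ Ico 0 ε, ContMDiff 𝓘(ℝ, E4) 𝓘(ℝ, ℂ) ∞ (Ψ δ)
  /-- `(g_δ, Ψ_δ)` solves the Einstein–Klein–Gordon equations with mass `μ²`. -/
  ekg : ∀ δ ∈ Ico 0 ε, ∀ [(g δ).HasLeviCivita], (g δ).IsEinsteinKleinGordon (μ ^ 2) (Ψ δ)
  /-- `∂_{t*}` and `∂_{φ*}` are Killing fields of `g_δ` (stationary and axisymmetric). -/
  killing : ∀ δ ∈ Ico 0 ε, ∀ [(g δ).HasLeviCivita],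
    (g δ).IsKillingField (Kerr.stationaryField a (Kerr.rPlus M a)) ∧
      (g δ).IsKillingField (Kerr.axialField a (Kerr.rPlus M a))
  /-- `Ψ_δ` is time-periodic with a non-zero frequency. -/
  periodic : ∀ δ ∈ Ico 0 ε, ∃ ϖ : ℝ, ϖ ≠ 0 ∧ IsTimePeriodicField a (Kerr.rPlus M a) (Ψ δ) ϖ
  /-- `Ψ_δ ≠ 0` for `δ > 0`. -/
  nonzero : ∀ δ ∈ Ioo 0 ε, ∃ x, Ψ δ x ≠ 0
  /-- The metric coefficients are differentiable in `δ` at `δ = 0⁺`. -/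
  metric_differentiable : ∀ (x : Kerr.exterior M a) (v w : E4),
    DifferentiableWithinAt ℝ (fun δ ↦ (g δ).val x v w) (Ici 0) 0
  /-- `δ⁻¹ Ψ_δ → Ψ̂` pointwise, `Ψ̂ ≠ 0` a smooth time-periodic Klein–Gordon solution on Kerr. -/
  field_hasDeriv : ∃ Ψhat : Kerr.exterior M a → ℂ,
    (∃ x, Ψhat x ≠ 0) ∧ ContMDiff 𝓘(ℝ, E4) 𝓘(ℝ, ℂ) ∞ Ψhat ∧
      (∀ x, (Kerr.smoothMetric M a (Kerr.rPlus M a)).dalembertian (fun y ↦ (Ψhat y).re) x =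
          μ ^ 2 * (Ψhat x).re) ∧
      (∀ x, (Kerr.smoothMetric M a (Kerr.rPlus M a)).dalembertian (fun y ↦ (Ψhat y).im) x =
          μ ^ 2 * (Ψhat x).im) ∧
      (∃ ϖ : ℝ, ϖ ≠ 0 ∧ IsTimePeriodicField a (Kerr.rPlus M a) Ψhat ϖ) ∧
      ∀ x, HasDerivWithinAt (fun δ ↦ Ψ δ x) (Ψhat x) (Ici 0) 0

/-- **Barrier (Chodosh–Shlapentokh-Rothman): Kerr bifurcates, within the Einstein–Klein–Gordon
system for suitable masses `μ² > 0`, into stationary axisymmetric black-hole spacetimes carrying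
a non-zero time-periodic scalar field; hence, for these masses, the Kerr family is not
asymptotically stable as a family of solutions of Einstein–Klein–Gordon, and the vacuum
expectations of black-hole stability and uniqueness do not survive the addition of this matter
model.** Vendored form: for the prelude's Kerr exteriors there are parameters `0 < |a| < M`,
`ε > 0`, a mass `μ > 0` and a family `δ ↦ (g_δ, Ψ_δ)` on `Kerr.exterior M a` with the clauses of
`IsHairyKerrFamily` (Thm. 1.1 (1), (2: Killing part), (3: non-zero, time-periodic), (4)).

BARRIER (D-0021; every clause is a quotation or close paraphrase of the cited locus):
* technique_class: matter-insensitive arguments — approaches to the asymptotic stability of the Kerr family, to the final-state picture, or to stationary black-hole uniqueness ("no hair") whose mechanism does not use the vacuum equations `Ric(g) = 0` specifically and would apply verbatim to the Einstein–Klein–Gordon system `Ric − ½ g R = 𝕋(g, Ψ)`, `□_g Ψ = μ² Ψ` with a mass `μ² > 0` (arguments from stationarity, axisymmetry, asymptotic flatness and a regular horizon alone; linear mechanisms indifferent to a zeroth-order term, cf. `KleinGordonSuperradiantInstability`).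
* blocks: the Einstein–Klein–Gordon analogues of Kerr asymptotic stability (CSR Conj. 1.1; prelude form `Literature.Geometry.Lorentzian.SubextremalKerrStabilityConjecture`, and clause (ii) `Literature.Geometry.Lorentzian.Development.SettlesToKerrFamily` of the final state conjecture) and of Kerr uniqueness (CSR Conj. 1.2; prelude schema `Literature.Geometry.Lorentzian.stationary_black_hole_uniqueness`) — "for these Klein–Gordon masses, the Kerr family is not asymptotically stable as a solution to the Einstein–Klein–Gordon equations" [cite: ChodoshShlapentokhrothman2017, abstract and Cor. 1.1]; "the addition of even a relatively simple matter model may completely change the expectations regarding black hole stability and uniqueness" [cite: ChodoshShlapentokhrothman2017, §1 (p. 4)]; hence any proof of the vacuum statements by a method in `technique_class`.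
* because: there are masses `μ² > 0` (a set of positive Lebesgue measure, Rmk. 1.1) and a one-parameter family `(𝓜, g_δ, Ψ_δ)`, `δ ∈ [0, ε)`, of smooth solutions of Einstein–Klein–Gordon, each spacetime "stationary, axisymmetric, asymptotically flat" with "a non-degenerate bifurcate event horizon", `Ψ_δ` "non-zero, time-periodic" for `δ > 0`, bifurcating off a Kerr exterior `0 < |a| < M` = `(𝓜, g_0)`, with `δ⁻¹Ψ_δ → Ψ̂ ≠ 0` [cite: ChodoshShlapentokhrothman2017, Thm. 1.1 and Rmk. 1.1]; for every `0 < |a| < M` such a family exists with `δ`-dependent mass `μ²(δ)` [cite: ChodoshShlapentokhrothman2017, Thm. 13.1]; the mechanism is superradiance — the "linear hair" (exactly time-periodic Klein–Gordon solutions on Kerr, "precisely at the threshold of superradiance" with "a vanishing energy flux along the event horizon", the Klein–Gordon mass treated "as an eigenvalue") "can be integrated to yield 'nonlinear hair'" [cite: ChodoshShlapentokhrothman2017, Rmk. 1.2, §1.1.1 (Thm. 1.3) and §2.2] [cite: ShlapentokhRothman2014KleinGordon, Thm. 1.1]; numerically the curve of solutions continues to a "continuous bridge between Kerr black holes and boson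 stars" [cite: HerdeiroRadu2014] [cite: ChodoshShlapentokhrothman2017, §1 (p. 4)].
* evasions_known: the massless/vacuum case is different — for `μ = 0` finite-energy waves on the full sub-extremal range have bounded energy and integrated decay, so "the natural analogue of the type of solution we construct [...] cannot exist when `μ = 0`" [cite: ChodoshShlapentokhrothman2017, §1.1.1 (Thm. 1.2)] [cite: DafermosRodnianskiShlapentokhrothman2014, Thm. 3.2]; Schwarzschild does not bifurcate: "all of the solutions constructed in Theorem 1.1 are rotating. It is not possible for the Schwarzschild solution to bifurcate in this manner, even at the linear level" [cite: ChodoshShlapentokhrothman2017, Rmk. 1.4]; the vacuum uniqueness results, which use `Ric(g) = 0` (static [Israel]; with a suitable axisymmetric Killing field [Carter, Robinson] — via the reduction of §2.1 to a harmonic map `(X, Y) : ℝ³ → ℍ²`; small perturbations of Kerr [Alexakis–Ionescu–Klainerman, Wong–Yu]; real-analytic [Chruściel–Costa, Hawking]), are untouched [cite: ChodoshShlapentokhrothman2017, §1 (p. 3) and §2.1]; no-hair statements for STATIONARY matter fields are not contradicted, the scalar field here being time-periodic ("due to the scalar field not being stationary, boson stars are not, strictly speaking, counter-examples to the generalized no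 hair conjecture") [cite: ChodoshShlapentokhrothman2017, §1.1.2].
* scope_caveats: (a) existence for SOME masses (a positive-measure set; for Thm. 13.1 every `0 < |a| < M` but `δ`-dependent mass) and, in the printed proof, "any sufficiently large azimuthal number `m`", a threshold frequency "`ω = cm` for a fixed constant `c` which depends only on the metric" and a mass with `μ² > ω²` — i.e. `μ² > c²m²` with `m` large; nothing is asserted for small masses at fixed `a ≠ 0`, for `a = 0`, or for `|a| ≥ M` [cite: ChodoshShlapentokhrothman2017, Rmk. 1.1, Rmk. 1.6, §2.2 and §11 (Lemma 11.1.1)]; (b) the vacuum final state conjecture and vacuum Kerr stability are NOT contradicted — the barrier constrains only matter-insensitive techniques; no dynamical statement (stability or instability of the hairy solutions, behaviour of general EKG perturbations of Kerr) is made beyond Cor. 1.1 [cite: ChodoshShlapentokhrothman2017, §1.2 (Open problems 1–4)]; (c) vendored on the fixed Kerr–Schild exterior `{r > r₊}` by transport along the `δ = 0` isometry, the identification of CSR's `∂_t`, `∂_φ` and `t`-flow with `Kerr.stationaryField`, `Kerr.axialField`, `Kerr.timeTranslate` being argued in the module docstring, not proved; asymptotic flatness of `g_δ` (their Prop. 13.2.1),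 the non-degenerate bifurcate horizon and the smooth horizon extension, the exponential spatial decay of `Ψ_δ`, the `e^{imφ}` dependence and Lipschitz/differentiable dependence in function spaces are NOT vendored — differentiability at `δ = 0` is recorded pointwise and one-sided only, `Ψ_0 = 0` and `ω ≠ 0` are read off clause (4) and §10.2 (p. 39) respectively; (d) `status` of the numerics [cite: HerdeiroRadu2014] beyond the small-`δ` regime: not a theorem; (e) [barrier audit 2026-08-15 — the corrected block is the docstring of `HairyKerrBifurcationNarrow` below] the words "to the final-state picture" in `technique_class` and the target "clause (ii) `Literature.Geometry.Lorentzian.Development.SettlesToKerrFamily` of the final state conjecture" in `blocks` are broader than the cited locus supports: Cor. 1.1 negates asymptotic stability of the Kerr FAMILY (every small perturbation, CSR Conj. 1.1) by one one-parameter family of non-decaying solutions and is silent on GENERIC-data final-state statements (the summit `FinalStateConjecture` is stated for Christodoulou-generic data) [cite: ChodoshShlapentokhrothman2017, Conj. 1.1 (p. 3) and Cor. 1.1 (p. 4)] [cite: DafermosLuk2017, p. 8], and `Development.SettlesToKerrFamily` is a predicate on the uninhabited prelude structure `Development` (`Literature.Geometry.Lorentzian.Development.isEmpty`); see `HairyKerrBifurcationNarrow`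 for the narrowed class, the added evasions (genericity; analyticity-at-`𝓘` inheritance theorems [cite: BicakScholtzTod2010, §1]) and the positive findings (slowly rotating Kerr is covered; every mass occurs by scaling).
* status: established — theorem [cite: ChodoshShlapentokhrothman2017, Thm. 1.1]. -/
def HairyKerrBifurcation : Prop :=
  ∀ [Kerr.Facts] [Kerr.SliceFacts],
    ∃ (M a ε μ : ℝ) (g : ℝ → LorentzianMetric 𝓘(ℝ, E4) ∞ (Kerr.exterior M a))
      (Ψ : ℝ → Kerr.exterior M a → ℂ), IsHairyKerrFamily M a ε μ g Ψ

namespace IsHairyKerrFamily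

variable [Kerr.Facts] [Kerr.SliceFacts] {M a ε μ : ℝ}
  {g : ℝ → LorentzianMetric 𝓘(ℝ, E4) ∞ (Kerr.exterior M a)} {Ψ : ℝ → Kerr.exterior M a → ℂ}

/-- The reference Kerr black hole of a hairy family is sub-extremal and rotating.
Chodosh–Shlapentokh-Rothman, CMP 356 (2017), Thm. 1.1 (4).
[cite: ChodoshShlapentokhrothman2017, Thm. 1.1] -/
theorem isSubextremal (h : IsHairyKerrFamily M a ε μ g Ψ) : Kerr.IsSubextremal M a ∧ a ≠ 0 :=
  ⟨h.param.2.1, abs_pos.mp h.param.1⟩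

/-- **Cor. 1.1 in vendored form: the hair is not stationary.** For `0 < δ < ε` the metric `g_δ`
is stationary (`∂_{t*}` is Killing, clause `killing`) but the scalar field is not invariant under
the stationary flow: `Ψ_δ ∘ φ_s ≠ Ψ_δ` for some `s` — "the scalar field does not decay to a
stationary solution. In particular, as a family of solutions to the Einstein–Klein–Gordon
equations, asymptotic stability does not hold for the Kerr family". Chodosh–Shlapentokh-Rothman,
CMP 356 (2017), Cor. 1.1. [cite: ChodoshShlapentokhrothman2017, Cor. 1.1] -/
theorem field_not_stationary (h : IsHairyKerrFamily M a ε μ g Ψ) {δ : ℝ} (hδ : δ ∈ Ioo 0 ε) :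
    ∃ (s : ℝ) (x : Kerr.exterior M a), Ψ δ (Kerr.timeTranslate a _ s x) ≠ Ψ δ x := by
  obtain ⟨x, hx⟩ := h.nonzero δ hδ
  obtain ⟨ϖ, hϖ, hper⟩ := h.periodic δ ⟨hδ.1.le, hδ.2⟩
  obtain ⟨s, hs⟩ := hper.exists_ne hϖ hx
  exact ⟨s, x, hs⟩

/-- **The hairy black holes are arbitrarily close to Kerr (metric).** Every metric coefficient
`g_δ(x)(v, w)` tends to the Kerr value `g_{M,a}(x)(v, w)` as `δ → 0⁺` (differentiability at
`δ = 0`, clause (4) of Thm. 1.1, read pointwise). Chodosh–Shlapentokh-Rothman, CMP 356 (2017),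
Thm. 1.1 (4) and Rmk. 1.3. [cite: ChodoshShlapentokhrothman2017, Thm. 1.1 and Rmk. 1.3] -/
theorem tendsto_metric (h : IsHairyKerrFamily M a ε μ g Ψ) (x : Kerr.exterior M a) (v w : E4) :
    Tendsto (fun δ ↦ (g δ).val x v w) (𝓝[Ici 0] 0)
      (𝓝 ((Kerr.smoothMetric M a (Kerr.rPlus M a)).val x v w)) := by
  have hc := (h.metric_differentiable x v w).continuousWithinAt
  rw [ContinuousWithinAt, h.metric_zero] at hc
  exact hc

/-- **The hairy black holes are arbitrarily close to Kerr (field).** `Ψ_δ(x) → 0 = Ψ_0(x)` as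
`δ → 0⁺` (from `δ⁻¹Ψ_δ → Ψ̂`). Chodosh–Shlapentokh-Rothman, CMP 356 (2017), Thm. 1.1 (4).
[cite: ChodoshShlapentokhrothman2017, Thm. 1.1] -/
theorem tendsto_field (h : IsHairyKerrFamily M a ε μ g Ψ) (x : Kerr.exterior M a) :
    Tendsto (fun δ ↦ Ψ δ x) (𝓝[Ici 0] 0) (𝓝 0) := by
  obtain ⟨Ψhat, -, -, -, -, -, hder⟩ := h.field_hasDeriv
  have hc := (hder x).continuousWithinAt
  rw [ContinuousWithinAt, h.field_zero] at hc
  simpa using hc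

/-- For `δ > 0` the solution is not vacuum-trivial: the scalar field does not vanish identically,
so `(g_δ, Ψ_δ)` is an Einstein–Klein–Gordon solution with `Ψ_δ ≠ 0` whose metric has the two
Kerr Killing fields. Chodosh–Shlapentokh-Rothman, CMP 356 (2017), Thm. 1.1 (1)–(3).
[cite: ChodoshShlapentokhrothman2017, Thm. 1.1] -/
theorem exists_nonvacuum_stationary (h : IsHairyKerrFamily M a ε μ g Ψ) {δ : ℝ} (hδ : δ ∈ Ioo 0 ε) :
    Ψ δ ≠ 0 ∧ (∀ [(g δ).HasLeviCivita], (g δ).IsEinsteinKleinGordon (μ ^ 2) (Ψ δ) ∧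
      (g δ).IsKillingField (Kerr.stationaryField a (Kerr.rPlus M a))) := by
  have hδ' : δ ∈ Ico 0 ε := ⟨hδ.1.le, hδ.2⟩
  refine ⟨fun h0 ↦ ?_, fun {_} ↦ ⟨h.ekg δ hδ', (h.killing δ hδ').1⟩⟩
  obtain ⟨x, hx⟩ := h.nonzero δ hδ
  exact hx (by simp [h0])

end IsHairyKerrFamily

/-- Consequence of the barrier fact in the shape of Cor. 1.1: given `HairyKerrBifurcation`, there
are a rotating sub-extremal Kerr exterior, a mass `μ > 0` and Einstein–Klein–Gordon solutions
`(g_δ, Ψ_δ)` on it, converging pointwise to `(g_{M,a}, 0)` as `δ → 0⁺`, each with stationary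
metric but non-stationary (time-periodic, non-zero) scalar field. Chodosh–Shlapentokh-Rothman,
CMP 356 (2017), Cor. 1.1. [cite: ChodoshShlapentokhrothman2017, Cor. 1.1] -/
theorem HairyKerrBifurcation.not_asymptotically_stable (h : HairyKerrBifurcation) [Kerr.Facts]
    [Kerr.SliceFacts] :
    ∃ (M a ε μ : ℝ) (g : ℝ → LorentzianMetric 𝓘(ℝ, E4) ∞ (Kerr.exterior M a))
      (Ψ : ℝ → Kerr.exterior M a → ℂ),
      Kerr.IsSubextremal M a ∧ a ≠ 0 ∧ 0 < ε ∧ 0 < μ ∧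
        g 0 = Kerr.smoothMetric M a (Kerr.rPlus M a) ∧
        (∀ (x : Kerr.exterior M a) (v w : E4), Tendsto (fun δ ↦ (g δ).val x v w) (𝓝[Ici 0] 0)
          (𝓝 ((Kerr.smoothMetric M a (Kerr.rPlus M a)).val x v w))) ∧
        (∀ x : Kerr.exterior M a, Tendsto (fun δ ↦ Ψ δ x) (𝓝[Ici 0] 0) (𝓝 0)) ∧
        ∀ δ ∈ Ioo 0 ε,
          (∀ [(g δ).HasLeviCivita], (g δ).IsEinsteinKleinGordon (μ ^ 2) (Ψ δ) ∧
              (g δ).IsKillingField (Kerr.stationaryField a (Kerr.rPlus M a))) ∧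
            ∃ (s : ℝ) (x : Kerr.exterior M a), Ψ δ (Kerr.timeTranslate a _ s x) ≠ Ψ δ x := by
  obtain ⟨M, a, ε, μ, g, Ψ, hf⟩ := h
  refine ⟨M, a, ε, μ, g, Ψ, hf.isSubextremal.1, hf.isSubextremal.2, hf.param.2.2.1,
    hf.param.2.2.2, hf.metric_zero, hf.tendsto_metric, hf.tendsto_field, fun δ hδ ↦ ⟨?_, ?_⟩⟩
  · intro _
    exact (hf.exists_nonvacuum_stationary hδ).2
  · exact hf.field_not_stationary hδ

/-! ### Barrier audit (2026-08-15): the narrowed block `HairyKerrBifurcationNarrow` (merged form) -/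

/-- **NARROWED BARRIER `HairyKerrBifurcationNarrow` (barrier audit of `HairyKerrBifurcation`, 2026-08-15; merged form, split review 2026-08-15).** Two conjuncts, both facts already vendored in this library and taken here as the HYPOTHESES `h₁`, `h₂` of a proved theorem (no named fact: the audit's `Prop`-valued named fact `HairyKerrBifurcationNarrow := (1) ∧ (2)` contained its parent as conjunct (1), was no proof obligation of its own, and was merged back into the two catalogued facts at the split review, D-0026): (1) = `HairyKerrBifurcation` — within Einstein–Klein–Gordon with a mass `μ² > 0` a rotating sub-extremal Kerr exterior bifurcates into stationary axisymmetric solutions `(g_δ, Ψ_δ)` carrying a non-zero time-periodic MASSIVE scalar field [cite: ChodoshShlapentokhrothman2017, Thm. 1.1 and Cor. 1.1 (p. 4)]; (2) its SHARP COMPLEMENT IN THE MASS PARAMETER — for `μ = 0` and EVERY sub-extremal `|a| < M`, the local energy of every admissible wave (`IsAdmissibleKerrWave`: smooth solution of `□_{g_{M,a}} ψ = 0` on `Kerr.exterior M a` with compactly supported data on `{t* = 0}`) through `{t* = τ} ∩ {‖y‖ ≤ R}` tends to `0` as `τ → ∞` (`Literature.Geometry.Lorentzian.drsr_wave_local_energy_decay_kerr`)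 [cite: DafermosRodnianskiShlapentokhrothman2014, Cor. 3.1] — the formal shadow of "finite energy solutions to the wave equation … decay to `0` on any compact set; in particular, the natural analogue of the type of solution we construct in Theorem 1.1 cannot exist when `μ = 0`" [cite: ChodoshShlapentokhrothman2017, §1.1.1 (Thm. 1.2, p. 5)]. The CONCLUSION is the mass dichotomy in consumer form: (1′) MASSIVE — for some rotating sub-extremal Kerr exterior `0 < |a| < M`, some `ε > 0` and some mass `μ > 0` there is a family `(g_δ, Ψ_δ)` on `Kerr.exterior M a` with `g_0 = g_{M,a}`, `g_δ → g_{M,a}` and `Ψ_δ → 0` pointwise as `δ → 0⁺` (a small perturbation of Kerr in the vendored, pointwise sense), and, for all `0 < δ < ε`, `(g_δ, Ψ_δ)` an Einstein–Klein–Gordon solution with stationary metric (`∂_{t*}` Killing) and a non-zero scalar field transforming under the stationary flow by a phase with non-zero frequency — exactly time-periodic, non-decaying hair [cite: ChodoshShlapentokhrothman2017, Thm. 1.1 and Cor. 1.1 (p. 4)]; (2′) MASSLESS — conjunct (2) verbatim. The audit (refuter, 2026-08-15) found the catalogued fact faithful and its caveats (a)–(d) honest, but its `technique_class`/`blocks`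 wording broader than the source supports in two respects — (N1) family-wise versus generic-data targets, (N2) a target predicate on an uninhabited prelude type — and records three positive findings (slowly rotating coverage, all masses by scaling, the analyticity-at-`𝓘` evasion), all entered in the block below with the pages re-read (pp. 3–5 of arXiv:1510.08025 and p. 14 of arXiv:1402.7034 re-read again at the split review).
BARRIER (D-0021), FinalStateConjecture (narrowing of the block on `HairyKerrBifurcation`):
* technique_class: MASS-TERM-blind stability and rigidity arguments for ROTATING Kerr — (i) any scheme concluding ASYMPTOTIC STABILITY of a sub-extremal Kerr exterior with `a ≠ 0` in the family-wise sense of CSR Conj. 1.1 ("the maximal Cauchy development of a small perturbation of sub-extremal Kerr initial data … asymptotically settles down to (a possibly different) Kerr exterior spacetime", i.e. EVERY small perturbation) [cite: ChodoshShlapentokhrothman2017, Conj. 1.1 (p. 3)] from ingredients that survive verbatim the passage from `Ric(g) = 0`, `□_g ψ = 0` to `Ric − ½ g R = 𝕋(g, Ψ)`, `□_g Ψ = μ² Ψ` with `μ² > 0` [cite: ChodoshShlapentokhrothman2017, §1 (pp. 3–4)] — in particular schemata "decay for general linear wave-type fields on Kerr, indifferent to a zeroth-order term ⟹ nonlinear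 stability" (the linear layer is the barrier `KleinGordonSuperradiantInstability` [cite: ChodoshShlapentokhrothman2017, Thm. 1.3 (p. 5)]; conjunct (2) records that the massless theory is NOT mass-blind); (ii) final-state or no-hair arguments routed through rigidity of a stationary (late-time limiting) METRIC with stationary energy–momentum tensor alone — CSR Conj. 1.2 read for `g` and `𝕋` without using that the matter FIELDS inherit the stationarity [cite: ChodoshShlapentokhrothman2017, Conj. 1.2 (p. 3) and §1.1.2 (p. 5)]. Tags: kerr-stability, asymptotic-stability-familywise, matter-blind, mass-term-blind, metric-only-rigidity.
* blocks: for techniques in this class — the vacuum family-wise target `Literature.Geometry.Lorentzian.SubextremalKerrStabilityConjecture` (CSR Conj. 1.1; Dafermos–Rodnianski Conj. 5.1) at every ROTATING parameter, the slowly rotating regime `0 < |a| ≪ M` included (the bifurcating parameters of the printed proof accumulate at `a = 0`, see `because`), and metric-only readings of stationary uniqueness (`Literature.Geometry.Lorentzian.stationary_black_hole_uniqueness`, CSR Conj. 1.2): "as a family of solutions to the Einstein–Klein–Gordon equations, asymptotic stability does not hold for the Kerr family" [cite: ChodoshShlapentokhrothman2017, Cor. 1.1 (p. 4)], "the addition of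 even a relatively simple matter model may completely change the expectations regarding black hole stability and uniqueness" [cite: ChodoshShlapentokhrothman2017, §1 (p. 4)]. NOT blocked by this fact (N1): GENERIC-data final-state statements — the summit `FinalStateConjecture` ("vacuum spacetimes arising from generic asymptotically flat Cauchy data … will either disperse or settle down to finitely many rotating Kerr black holes" [cite: DafermosLuk2017, p. 8]) and mass-blind techniques aimed at it that concede a positive-codimension exceptional set of data — because Cor. 1.1 exhibits ONE one-parameter family of non-decaying solutions (the hairy black holes themselves as Cauchy data), about whose own stability the source makes no claim (its open problems concern extending the family, excited states, uniqueness and other asymptotics) [cite: ChodoshShlapentokhrothman2017, §1.2 (Open problems 1–4, p. 6)], and which is numerically superradiantly unstable in turn ("We find unstable modes with characteristic growth rates which for uniformly small hair are almost identical to those of a massive scalar field on a fixed Kerr background" [cite: GanchevSantos2018, abstract]; "superradiant instabilities triggered by perturbation modes with azimuthal harmonic index `m̃` larger than that of the background should afflict the hairy BHs … shown to occur … by Ganchev and Santos", with "effective stability" a statement about time-scales only [cite: DegolladoHerdeiroRadu2018, pp. 2–3 and 6]); what does constrain mass-blind GENERIC-data techniques is the linear instability of rotating Kerr itself in the matter model,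 catalogued separately (`KleinGordonSuperradiantInstability`) [cite: ChodoshShlapentokhrothman2017, Thm. 1.3 (p. 5)]. (N2) The target "clause (ii) `Literature.Geometry.Lorentzian.Development.SettlesToKerrFamily`" of the catalogued block is a predicate on the prelude structure `Development`, which is uninhabited (`Literature.Geometry.Lorentzian.Development.isEmpty`); the summit's settling clause is the `FinalStateDecomposition` of `Summit.FinalStateConjecture` over `CauchyDevelopment`, and `SubextremalKerrStabilityConjecture` itself still quantifies over the equally uninhabited `VacuumDevelopment` (`Literature.Geometry.Lorentzian.VacuumDevelopment.isEmpty`) pending the prelude repair — the barrier addresses the printed conjectures, whatever their current rendering.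
* because: conjunct (1): for a positive-measure set of masses `μ² > 0` a one-parameter family `(𝓜, g_δ, Ψ_δ)`, `δ ∈ [0, ε)`, of smooth stationary axisymmetric asymptotically flat Einstein–Klein–Gordon black holes with non-degenerate bifurcate horizon, `Ψ_δ` non-zero and time-periodic for `δ > 0`, bifurcating off a Kerr exterior `0 < |a| < M` with `δ⁻¹Ψ_δ → Ψ̂ ≠ 0` [cite: ChodoshShlapentokhrothman2017, Thm. 1.1 and Rmk. 1.1 (p. 4)], obtained from the `δ`-dependent-mass families which exist for EVERY `0 < |a| < M` [cite: ChodoshShlapentokhrothman2017, Thm. 13.1 (p. 58)] by a constant-mass reparametrisation `a(δ)`, `M(δ) = √(γ² + a(δ)²)` at the points `a ∈ 𝔇` where `d/da μ²(a, M(a), 0)` exists and is non-zero [cite: ChodoshShlapentokhrothman2017, §13.4 (Lemmas 13.4.1–13.4.2 and proof of Thm. 1.1, pp. 58–59)]; SLOWLY ROTATING KERR IS COVERED: at fixed `γ`, `a ↦ μ²(a, M(a), 0)` is Lipschitz, `> ω² > 0` for `a > 0` and `→ 0` as `a → 0` ("no superradiance on Schwarzschild") [cite: ChodoshShlapentokhrothman2017,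 §13.4 (p. 58)], so `𝔇` meets every interval `(0, a₀)` in positive measure (absolute continuity; in Lean `HairyKerrBifurcation.volume_pos_setOf_exists_constMassCurve` of `HairyKerrBifurcationProofs`, applied on `(0, a₀)`), i.e. bifurcation occurs at arbitrarily small `|a|/M`, with large azimuthal number `m` and mass `μ² > ω² = c²m²` [cite: ChodoshShlapentokhrothman2017, Rmk. 1.6 (p. 6) and §2.2]; EVERY MASS OCCURS: the system `Ric − ½ g R = 𝕋`, `□_g Ψ = μ²Ψ` is invariant under `(g, Ψ, μ) ↦ (λ² g, Ψ, μ/λ)`, which maps Kerr `(M, a)` to Kerr `(λM, λa)`, so once `(M, a)` ranges over the whole sub-extremal family the restriction "for these Klein–Gordon masses" of Cor. 1.1 is void [folklore]; the mechanism is superradiance at its threshold — synchronised bound states `ω = m Ω_H < μ` with vanishing horizon flux, the mass "as an eigenvalue", "linear hair … integrated to yield nonlinear hair" [cite: ChodoshShlapentokhrothman2017, Rmk. 1.2 (p. 4) and §1.1.1 (p. 5)] [cite: DegolladoHerdeiroRadu2018, p. 2 ("synchronisation … `Ω_H = ω/m`")] [cite: HerdeiroRadu2014]. Conjunct (2): for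 `μ = 0` finite-energy waves on the full sub-extremal range have bounded energy and integrated decay, hence decay on compact sets [cite: ChodoshShlapentokhrothman2017, §1.1.1 (Thm. 1.2, p. 5)] [cite: DafermosRodnianskiShlapentokhrothman2014, Thm. 3.1 and Cor. 3.1] — the obstruction of conjunct (1) is carried entirely by the mass term.
* evasions_known: those of `HairyKerrBifurcation` — vacuum-specific uniqueness proofs (static; axisymmetric Carter–Robinson reduction; perturbative Alexakis–Ionescu–Klainerman, Wong–Yu; real-analytic) [cite: ChodoshShlapentokhrothman2017, §1 (p. 3) and §2.1], the massless case (conjunct (2)), Schwarzschild ("It is not possible for the Schwarzschild solution to bifurcate in this manner, even at the linear level" [cite: ChodoshShlapentokhrothman2017, Rmk. 1.4 (p. 4)]), no-hair theorems for matter fields that ARE stationary ("boson stars are not, strictly speaking, counter-examples to the generalized no hair conjecture" [cite: ChodoshShlapentokhrothman2017, §1.1.2 (p. 5)]) — and further: (E1) GENERICITY — arguments that concede a positive-codimension exceptional set of data or of limiting configurations (Christodoulou genericity, as in the summit statement) are untouched by a one-parameter family of stationary-metric solutions [cite: ChodoshShlapentokhrothman2017, Cor. 1.1 (p. 4)] [cite: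 DafermosLuk2017, p. 8] (N1 above); (E2) ANALYTICITY AT `𝓘` — "periodic ⟹ stationary" and symmetry-inheritance theorems for Einstein–Klein–Gordon, mass term included "subject to a weak condition on the potential", for solutions "analytic in a neighbourhood of `𝓘⁻`" are not contradicted: boson stars "are genuinely periodic in time but not stationary … However, it is easy to see that these solutions are not analytic near `𝓘`, which is why they do not violate our result" [cite: BicakScholtzTod2010, §1 (Thm. 1 and the paragraph following it)], and the same applies to the exponentially decaying hair of Thm. 1.1 (3) (a non-zero field `O(e^{−cr})` is flat, not analytic, at `𝓘`) [folklore] — for generic VACUUM developments such analyticity hypotheses are themselves barred (`NonSmoothNullInfinity`); (E3) VACUUM STRUCTURE — proofs that use the algebraic structure of `Ric = 0` (Bianchi/Teukolsky system, generally covariant modulated gauges), such as the nonlinear stability of slowly rotating Kerr [cite: GiorgiKlainermanSzeftel2022, p. 23], lie outside the class by definition, although their parameter range `|a| ≪ M` is inside the barrier's (see `because`).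
* scope_caveats: (a)–(d) of `HairyKerrBifurcation` stand; (e) conjunct (2) is stated for the compactly-supported-data class of DRSR §4.1 on the Kerr–Schild leaves, the formal shadow of "finite energy" in CSR Thm. 1.2, and in local-energy (not pointwise) form [cite: DafermosRodnianskiShlapentokhrothman2014, Cor. 3.1]; (f) FORMAL STRENGTH — the vendored family converges to `(g_{M,a}, 0)` only POINTWISE on the open exterior chart (`IsHairyKerrFamily.tendsto_metric`, `tendsto_field`); the weighted-Hölder differentiability of Rmk. 1.3 and the exponential spatial decay of clause (3) [cite: ChodoshShlapentokhrothman2017, Thm. 1.1 (3) and Rmk. 1.3 (p. 4)] are not vendored, so a FORMAL contradiction between `HairyKerrBifurcation` and a norm-based Einstein–Klein–Gordon rendering of `SubextremalKerrStabilityConjecture` (data `ε`-close in `H^s_δ × H^{s−1}_{δ+1}`) requires vendoring those clauses first — the barrier is, in Lean, advisory for such targets; (g) the slowly-rotating coverage and the all-masses scaling are recorded from the printed proof and the scaling symmetry respectively; neither is a clause of `IsHairyKerrFamily`; (h) the instability of the hairy black holes [cite: GanchevSantos2018, abstract] [cite: DegolladoHerdeiroRadu2018, pp. 2–3] is numerical,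 not a theorem, and nothing here asserts what the generic late-time behaviour of Einstein–Klein–Gordon perturbations of Kerr is.
* status: established — conjunct (1) [cite: ChodoshShlapentokhrothman2017, Thm. 1.1] and conjunct (2) [cite: DafermosRodnianskiShlapentokhrothman2014, Cor. 3.1] are vendored named facts of this library (`HairyKerrBifurcation`; `drsr_wave_local_energy_decay_kerr`, itself derived from `drsr_wave_polynomial_decay_kerr` by `drsr_wave_local_energy_decay_kerr_of_polynomial_decay`), the hypotheses of this theorem; the dichotomy is proved here from them, so the narrowed block is closed modulo exactly those two catalogued facts. -/
theorem HairyKerrBifurcationNarrow (h₁ : HairyKerrBifurcation)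
    (h₂ : drsr_wave_local_energy_decay_kerr) [Kerr.Facts] [Kerr.SliceFacts] :
    (∃ (M a ε μ : ℝ) (g : ℝ → LorentzianMetric 𝓘(ℝ, E4) ∞ (Kerr.exterior M a))
        (Ψ : ℝ → Kerr.exterior M a → ℂ),
        Kerr.IsSubextremal M a ∧ a ≠ 0 ∧ 0 < ε ∧ 0 < μ ∧
          g 0 = Kerr.smoothMetric M a (Kerr.rPlus M a) ∧
          (∀ (x : Kerr.exterior M a) (v w : E4), Tendsto (fun δ ↦ (g δ).val x v w) (𝓝[Ici 0] 0)
            (𝓝 ((Kerr.smoothMetric M a (Kerr.rPlus M a)).val x v w))) ∧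
          (∀ x : Kerr.exterior M a, Tendsto (fun δ ↦ Ψ δ x) (𝓝[Ici 0] 0) (𝓝 0)) ∧
          ∀ δ ∈ Ioo 0 ε,
            (∀ [(g δ).HasLeviCivita], (g δ).IsEinsteinKleinGordon (μ ^ 2) (Ψ δ) ∧
                (g δ).IsKillingField (Kerr.stationaryField a (Kerr.rPlus M a))) ∧
              Ψ δ ≠ 0 ∧ ∃ ϖ : ℝ, ϖ ≠ 0 ∧ IsTimePeriodicField a (Kerr.rPlus M a) (Ψ δ) ϖ) ∧
      ∀ (M a : ℝ), Kerr.IsSubextremal M a → ∀ ψ : Kerr.exterior M a → ℝ,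
        IsAdmissibleKerrWave M a ψ → ∀ R : ℝ,
          Tendsto (fun τ : ℝ ↦ localSliceEnergy (Kerr.exterior M a) ψ τ R) atTop (𝓝 0) := by
  refine ⟨?_, fun M a hMa ψ hψ R ↦ h₂ M a hMa ψ hψ R⟩
  obtain ⟨M, a, ε, μ, g, Ψ, hf⟩ := h₁
  refine ⟨M, a, ε, μ, g, Ψ, hf.isSubextremal.1, hf.isSubextremal.2, hf.param.2.2.1,
    hf.param.2.2.2, hf.metric_zero, hf.tendsto_metric, hf.tendsto_field, fun δ hδ ↦
      ⟨?_, (hf.exists_nonvacuum_stationary hδ).1, hf.periodic δ ⟨hδ.1.le, hδ.2⟩⟩⟩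
  intro _
  exact (hf.exists_nonvacuum_stationary hδ).2

/-- **The narrowed barrier from the two vendored facts, in the words of Cor. 1.1 and Thm. 1.2.**
(1) "There exist Klein–Gordon masses, a sub-extremal Kerr spacetime, and a small
Einstein–Klein–Gordon perturbation such that the scalar field does not decay to a stationary
solution": from `HairyKerrBifurcation`, a rotating sub-extremal Kerr exterior, a mass `μ > 0` and
Einstein–Klein–Gordon solutions `(g_δ, Ψ_δ)`, `0 < δ < ε`, converging pointwise to `(g_{M,a}, 0)`
as `δ → 0⁺`, each with stationary metric (`∂_{t*}` Killing) but a scalar field that is NOT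
invariant under the stationary flow `Kerr.timeTranslate`
(`HairyKerrBifurcation.not_asymptotically_stable`); (2) "the natural analogue of the type of
solution we construct in Theorem 1.1 cannot exist when `μ = 0`": from
`drsr_wave_local_energy_decay_kerr`, local energy decay of every admissible massless wave on
every sub-extremal Kerr exterior. (The name is kept from the audit's version, whose conclusion was
the conjunction of the two facts itself; the block-carrying form is `HairyKerrBifurcationNarrow`.)
Chodosh–Shlapentokh-Rothman, CMP 356 (2017), Cor. 1.1 (p. 4) and §1.1.1 (Thm. 1.2, p. 5);
Dafermos–Rodnianski–Shlapentokh-Rothman, Ann. of Math. 183 (2016), Cor. 3.1.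
[cite: ChodoshShlapentokhrothman2017, Cor. 1.1 and §1.1.1 (Thm. 1.2)] -/
theorem HairyKerrBifurcationNarrow.of_facts (h₁ : HairyKerrBifurcation)
    (h₂ : drsr_wave_local_energy_decay_kerr) [Kerr.Facts] [Kerr.SliceFacts] :
    (∃ (M a ε μ : ℝ) (g : ℝ → LorentzianMetric 𝓘(ℝ, E4) ∞ (Kerr.exterior M a))
        (Ψ : ℝ → Kerr.exterior M a → ℂ),
        Kerr.IsSubextremal M a ∧ a ≠ 0 ∧ 0 < ε ∧ 0 < μ ∧
          g 0 = Kerr.smoothMetric M a (Kerr.rPlus M a) ∧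
          (∀ (x : Kerr.exterior M a) (v w : E4), Tendsto (fun δ ↦ (g δ).val x v w) (𝓝[Ici 0] 0)
            (𝓝 ((Kerr.smoothMetric M a (Kerr.rPlus M a)).val x v w))) ∧
          (∀ x : Kerr.exterior M a, Tendsto (fun δ ↦ Ψ δ x) (𝓝[Ici 0] 0) (𝓝 0)) ∧
          ∀ δ ∈ Ioo 0 ε,
            (∀ [(g δ).HasLeviCivita], (g δ).IsEinsteinKleinGordon (μ ^ 2) (Ψ δ) ∧
                (g δ).IsKillingField (Kerr.stationaryField a (Kerr.rPlus M a))) ∧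
              ∃ (s : ℝ) (x : Kerr.exterior M a), Ψ δ (Kerr.timeTranslate a _ s x) ≠ Ψ δ x) ∧
      ∀ (M a : ℝ), Kerr.IsSubextremal M a → ∀ ψ : Kerr.exterior M a → ℝ,
        IsAdmissibleKerrWave M a ψ → ∀ R : ℝ,
          Tendsto (fun τ : ℝ ↦ localSliceEnergy (Kerr.exterior M a) ψ τ R) atTop (𝓝 0) :=
  ⟨h₁.not_asymptotically_stable, fun M a hMa ψ hψ R ↦ h₂ M a hMa ψ hψ R⟩

end Literature.Barriers.FinalStateConjecture

end
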